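import Mathlib
import HarnessLib
import Summits.HubbardSuperconductivity.HubbardSuperconductivity.Theorems.KLProgrammeKLRegimeSplitPhValueExchange

/-!
# Route `KLProgramme` — ENGINE (stmt-HubbardSuperconductivity-20437 `KLRegimeEngineV17F2`), row (c) binder #8 (★ v19 `hexLadMV`), the EXCHANGE p-h row `RQ` at the exchange diagonal
# `Qm = x + y`, STRUCTURE HALF (brick O6h-a): the up/down shifts of the Matsubara label as mutual inverses off the boundary labels, the REINDEXING of the first bubble
# ordering onto the hard line's label, the vanishing of the hard line at the boundary labels, and the ABSTRACT decomposition
# `Σ_{p≠bottom}((soft p)(hard p⁻) + (hard p)(soft p⁻))F p p⁻ = Σ_pΣ_s(hard·soft)(p)·![F p⁺ p, F p p⁻] s + Σ_p hard p·((soft p⁺ − soft p)F p⁺ p + (soft p⁻ − soft p)F p p⁻)`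
# with the sign-blind bound of the correction — the bound itself (O6h-b) is `…SplitPhValueExchangeBound`
# (cell gate-hubbard-kl, seat hubbard-kl-k3c2-p2 g32, technique «thermal-bar induction n ≤ nScales β + 1 with EngineBoundsAtV4S sums»)

WHY.  E1-LEDGER rev 13/14 line #8 books `RQ` as «the same spatial object with the partner frequency shifted by the pinned transfer: rotation part + a resolvent-identity correction
`∝ (π/β)/Λ` = thermal».  O6g (`klph_exchangeRow_diag_eq`) wrote the rows door's `hQ` object at `Qm = x + y` as `Σ_p [p.1 ≠ bottom]((Φĝ)(p)(Ẇĝ)(p⁻) + (Ẇĝ)(p)(Φĝ)(p⁻))·F p p⁻`.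
Here: (§1) the UP-shift `τ` (inverse of the down-shift `σ` off the boundary labels); (§2) the reindexing `Σ_{p ≠ bottom} g(p, p⁻) = Σ_{q ≠ top} g(q⁺, q)` of the first ordering, so
that the HARD line `Ẇ` always sits at the summation label; (§3) the hard line vanishes at the two boundary labels once `βΛ(t)/(2π) + 1 ≤ M` (their frequency `π(2M−1)/β`
exceeds `Λ(t)`), so the indicators drop; (§4) the decomposition `(Φĝ)(p^±) = (Φĝ)(p) + [(Φĝ)(p^±) − (Φĝ)(p)]` with `‖(Φĝ)(p^±) − (Φĝ)(p)‖ ≤ ‖ĝ(p)‖·(q₀‖ĝ(p^±)‖ + εΦ)`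
(O6d `klod_norm_propCT_sub_propCT_le`, `|Φ| ≤ 1`), against the hard line `|Ẇ|‖ĝ‖ ≤ (128/3)/Λ(t)²` and `‖ĝ‖ ≤ 2/Λ(t)` on the shell:

* `klph_exists_upShiftIdx`, `klph_up_down` / `klph_down_up`, `klph_abs_upShift_freq_sub_le` (§1); **`klph_sum_shift_reindex`** (§2); `klph_abs_freq_boundary`,
  **`klph_derivWeight_eq_zero_of_boundary`** (§3: `βΛ/(2π) + 1 ≤ M ⇒ Ẇ_Λ = 0` at the bottom/top label); **`klph_exchange_decomp_abstract`**, **`klph_exchange_corr_abstract_le`**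
  (§4: `‖correction‖ ≤ #{hard ≠ 0}·(H·(2·E·F∞))` from `‖hard‖ ≤ H`, `‖soft p^± − soft p‖ ≤ E`, `‖F‖ ≤ F∞` on the support of `hard`).
Pure finite-sum algebra; no definitions; nothing asserts (c), K3 or superconductivity.  [cite: BenfattoGiulianiMastropietro2006, §2.5]
-/

noncomputable section

namespace Summit.HubbardSuperconductivity.HubbardSuperconductivity.Theorems.KLRegimeSplit

set_option linter.dupNamespace false -- summit = problem name (single-conjunct summit), D-0017

open Real Set Finset Literature.MathematicalPhysics.QuantumLattice
open Literature.Probability.LatticeModels hiding torusSupNorm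
open Literature.MathematicalPhysics.QuantumLattice.BandSectorCounting
open Summit.HubbardSuperconductivity.HubbardSuperconductivity.Theorems.TwoPointAssembly
open Summit.HubbardSuperconductivity.HubbardSuperconductivity.Theorems.KLProgrammeLegKernels
open Summit.HubbardSuperconductivity.HubbardSuperconductivity.Theorems.KLRegimeWick
open Summit.HubbardSuperconductivity.HubbardSuperconductivity.Theorems.EngineV8
open Summit.HubbardSuperconductivity.HubbardSuperconductivity.Theorems.DispersionFlow
open Summit.HubbardSuperconductivity.HubbardSuperconductivity.Theorems.PerturbedFermiCurve

variable {L M : ℕ} [NeZero L] [NeZero M]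

/-! ## §1 The up-shift and the two shifts as mutual inverses off the boundary labels -/

omit [NeZero L] in
/-- **The up-shift exists**: `matsubaraInt (τ ν) = matsubaraInt ν + 1` off the top label (`(ν : ℕ) ≠ 2M − 1`), `τ ν = ν` at it. -/
theorem klph_exists_upShiftIdx (M : ℕ) [NeZero M] :
    ∃ τ : MatsubaraIdx M → MatsubaraIdx M,
      (∀ ν : MatsubaraIdx M, (ν : ℕ) ≠ 2 * M - 1 → matsubaraInt M (τ ν) = matsubaraInt M ν + 1) ∧ (∀ ν : MatsubaraIdx M, (ν : ℕ) = 2 * M - 1 → τ ν = ν) := by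
  refine ⟨fun ν => if h : (ν : ℕ) = 2 * M - 1 then ν else ⟨(ν : ℕ) + 1, by have := ν.isLt; omega⟩, fun ν hν => ?_, fun ν hν => ?_⟩
  · simp only [hν, ↓reduceDIte, matsubaraInt]
    push_cast
    ring
  · simp only [hν, ↓reduceDIte]

omit [NeZero L] [NeZero M] in
/-- The integer label lies in `[−M, M−1]`. -/
theorem klph_matsubaraInt_bounds (ν : MatsubaraIdx M) : -(M : ℤ) ≤ matsubaraInt M ν ∧ matsubaraInt M ν ≤ (M : ℤ) - 1 := by
  have := ν.isLt
  simp only [matsubaraInt]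
  omega

omit [NeZero L] [NeZero M] in
/-- Bottom label ⟺ integer label `−M`. -/
theorem klph_bottom_iff (ν : MatsubaraIdx M) : (ν : ℕ) = 0 ↔ matsubaraInt M ν = -(M : ℤ) := by
  simp only [matsubaraInt]
  omega

omit [NeZero L] [NeZero M] in
/-- Top label ⟺ integer label `M − 1`. -/
theorem klph_top_iff (ν : MatsubaraIdx M) : (ν : ℕ) = 2 * M - 1 ↔ matsubaraInt M ν = (M : ℤ) - 1 := by
  have := ν.isLt
  simp only [matsubaraInt]
  omega

section Shifts

variable {σ τ : MatsubaraIdx M → MatsubaraIdx M}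
  (hσ : ∀ ν : MatsubaraIdx M, (ν : ℕ) ≠ 0 → matsubaraInt M (σ ν) = matsubaraInt M ν - 1)
  (hτ : ∀ ν : MatsubaraIdx M, (ν : ℕ) ≠ 2 * M - 1 → matsubaraInt M (τ ν) = matsubaraInt M ν + 1)
include hσ hτ

omit [NeZero L] [NeZero M] hτ in
/-- The down-shift of a non-bottom label is not the top label. -/
theorem klph_shift_ne_top {ν : MatsubaraIdx M} (hν : (ν : ℕ) ≠ 0) : ((σ ν : MatsubaraIdx M) : ℕ) ≠ 2 * M - 1 := by
  rw [Ne, klph_top_iff, hσ ν hν]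
  have := (klph_matsubaraInt_bounds ν).2
  omega

omit [NeZero L] [NeZero M] hσ in
/-- The up-shift of a non-top label is not the bottom label. -/
theorem klph_upShift_ne_bottom {ν : MatsubaraIdx M} (hν : (ν : ℕ) ≠ 2 * M - 1) : ((τ ν : MatsubaraIdx M) : ℕ) ≠ 0 := by
  rw [Ne, klph_bottom_iff, hτ ν hν]
  have := (klph_matsubaraInt_bounds ν).1
  omega

omit [NeZero L] [NeZero M] in
/-- `τ (σ ν) = ν` off the bottom label. -/
theorem klph_up_down {ν : MatsubaraIdx M} (hν : (ν : ℕ) ≠ 0) : τ (σ ν) = ν := by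
  apply matsubaraInt_injective M
  rw [hτ _ (klph_shift_ne_top hσ hν), hσ ν hν]
  ring

omit [NeZero L] [NeZero M] in
/-- `σ (τ ν) = ν` off the top label. -/
theorem klph_down_up {ν : MatsubaraIdx M} (hν : (ν : ℕ) ≠ 2 * M - 1) : σ (τ ν) = ν := by
  apply matsubaraInt_injective M
  rw [hσ _ (klph_upShift_ne_bottom hτ hν), hτ ν hν]
  ring

omit [NeZero L] [NeZero M] hσ in
/-- **The up-shift is thermal too**: `|ω_{τν} − ω_ν| ≤ 2π/β` (`0 < β`; `τ` the identity at the top). -/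
theorem klph_abs_upShift_freq_sub_le {β : ℝ} (hβ : 0 < β) (hτ0 : ∀ ν : MatsubaraIdx M, (ν : ℕ) = 2 * M - 1 → τ ν = ν) (ν : MatsubaraIdx M) :
    |matsubaraFreq β M (τ ν) - matsubaraFreq β M ν| ≤ 2 * π / β := by
  by_cases hν : (ν : ℕ) = 2 * M - 1
  · rw [hτ0 ν hν, sub_self, abs_zero]; positivity
  · have : matsubaraFreq β M (τ ν) - matsubaraFreq β M ν = 2 * π / β := by
      simp only [matsubaraFreq, hτ ν hν]; push_cast; ring
    rw [this, abs_of_pos (by positivity)]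

/-! ## §2 Reindexing the first bubble ordering onto the hard line's label -/

omit [NeZero M] in
/-- **Reindexing**: for any `g`, `Σ_p [p.1 ≠ bottom]·g p (σ p.1, p.2) = Σ_q [q.1 ≠ top]·g (τ q.1, q.2) q` (`q = p⁻ ⟺ p = q⁺`). -/
theorem klph_sum_shift_reindex [NeZero M] (g : FreqMomentum L M → FreqMomentum L M → ℂ) :
    (∑ p : FreqMomentum L M, if (p.1 : ℕ) = 0 then 0 else g p (σ p.1, p.2)) =
      ∑ q : FreqMomentum L M, if (q.1 : ℕ) = 2 * M - 1 then 0 else g (τ q.1, q.2) q := by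
  classical
  rw [← sum_filter_not_add_sum_filter univ (fun p : FreqMomentum L M => (p.1 : ℕ) = 0),
    ← sum_filter_not_add_sum_filter univ (fun q : FreqMomentum L M => (q.1 : ℕ) = 2 * M - 1)]
  have hz1 : ∑ p ∈ univ.filter (fun p : FreqMomentum L M => (p.1 : ℕ) = 0), (if (p.1 : ℕ) = 0 then 0 else g p (σ p.1, p.2)) = 0 :=
    sum_eq_zero fun p hp => by rw [if_pos (mem_filter.mp hp).2]
  have hz2 : ∑ q ∈ univ.filter (fun q : FreqMomentum L M => (q.1 : ℕ) = 2 * M - 1), (if (q.1 : ℕ) = 2 * M - 1 then 0 else g (τ q.1, q.2) q) = 0 :=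
    sum_eq_zero fun q hq => by rw [if_pos (mem_filter.mp hq).2]
  rw [hz1, hz2, add_zero, add_zero]
  refine sum_nbij' (fun p => (σ p.1, p.2)) (fun q => (τ q.1, q.2)) (fun p hp => ?_) (fun q hq => ?_) (fun p hp => ?_) (fun q hq => ?_) (fun p hp => ?_)
  · have hp' : (p.1 : ℕ) ≠ 0 := (mem_filter.mp hp).2
    exact mem_filter.mpr ⟨mem_univ _, klph_shift_ne_top hσ hp'⟩
  · have hq' : (q.1 : ℕ) ≠ 2 * M - 1 := (mem_filter.mp hq).2
    exact mem_filter.mpr ⟨mem_univ _, klph_upShift_ne_bottom hτ hq'⟩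
  · have hp' : (p.1 : ℕ) ≠ 0 := (mem_filter.mp hp).2
    exact Prod.ext (klph_up_down hσ hτ hp') rfl
  · have hq' : (q.1 : ℕ) ≠ 2 * M - 1 := (mem_filter.mp hq).2
    exact Prod.ext (klph_down_up hσ hτ hq') rfl
  · have hp' : (p.1 : ℕ) ≠ 0 := (mem_filter.mp hp).2
    simp only [if_neg hp', if_neg (klph_shift_ne_top hσ hp'), klph_up_down hσ hτ hp']

end Shifts

/-! ## §3 The hard line vanishes at the two boundary labels -/

omit [NeZero L] [NeZero M] in
/-- The boundary frequencies: `|ω_ν| = π(2M−1)/β` at the bottom and at the top label. -/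
theorem klph_abs_freq_boundary (β : ℝ) (hβ : 0 < β) {ν : MatsubaraIdx M} (hν : (ν : ℕ) = 0 ∨ (ν : ℕ) = 2 * M - 1) :
    |matsubaraFreq β M ν| = π * (2 * M - 1) / β := by
  have hlt := ν.isLt
  rcases hν with hν | hν
  · have hi : matsubaraInt M ν = -(M : ℤ) := (klph_bottom_iff ν).mp hν
    simp only [matsubaraFreq, hi]; push_cast
    rw [show π * (2 * -(M : ℝ) + 1) / β = -(π * (2 * M - 1) / β) by ring, abs_neg, abs_of_nonneg]
    have : (1 : ℝ) ≤ M := by exact_mod_cast (show 1 ≤ M by omega)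
    exact div_nonneg (by nlinarith [Real.pi_pos]) hβ.le
  · have hi : matsubaraInt M ν = (M : ℤ) - 1 := (klph_top_iff ν).mp hν
    simp only [matsubaraFreq, hi]; push_cast
    rw [show π * (2 * ((M : ℝ) - 1) + 1) / β = π * (2 * M - 1) / β by ring, abs_of_nonneg]
    have : (1 : ℝ) ≤ M := by exact_mod_cast (show 1 ≤ M by omega)
    exact div_nonneg (by nlinarith [Real.pi_pos]) hβ.le

omit [NeZero L] [NeZero M] in
/-- **The hard line vanishes at the boundary labels**: if `βΛ/(2π) + 1 ≤ M` (`0 < β`, `0 < Λ`) then `Ẇ_Λ(ν, k̃) = 0` for `ν` the bottom or the top label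
(their `|ω| = π(2M−1)/β > Λ`, outside the shell `ω² + e² ≤ Λ²`). -/
theorem klph_derivWeight_eq_zero_of_boundary {β : ℝ} (hβ : 0 < β) (μ : ℝ) (K : TrigPolyC4v) {Λ : ℝ} (hΛ : 0 < Λ) (hM : β * Λ / (2 * Real.pi) + 1 ≤ M)
    {ν : MatsubaraIdx M} (hν : (ν : ℕ) = 0 ∨ (ν : ℕ) = 2 * M - 1) (k : TorusSite 2 L) :
    deriv (fun Λ' : ℝ => hubbardCutoffWeightCT L M β μ K Λ' (ν, k)) Λ = 0 := by
  apply klws_deriv_cutoffWeight_scale_eq_zero L M β μ K hΛ.ne'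
  right
  have hω : Λ < |matsubaraFreq β M ν| := by
    rw [klph_abs_freq_boundary β hβ hν, lt_div_iff₀ hβ]
    have h2 : β * Λ / (2 * π) ≤ (M : ℝ) - 1 := by linarith
    have h3 := (div_le_iff₀ (by positivity : (0 : ℝ) < 2 * π)).mp h2
    nlinarith [Real.pi_pos]
  have hsq : Λ ^ 2 < matsubaraFreq β M ν ^ 2 := by
    rw [← sq_abs (matsubaraFreq β M ν)]
    exact pow_lt_pow_left₀ hω hΛ.le two_ne_zero
  simp only
  nlinarith [sq_nonneg (nambuXiCT L μ K k)]

/-! ## §4 The decomposition and the bound -/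

section Decomp

variable {σ τ : MatsubaraIdx M → MatsubaraIdx M}
  (hσ : ∀ ν : MatsubaraIdx M, (ν : ℕ) ≠ 0 → matsubaraInt M (σ ν) = matsubaraInt M ν - 1)
  (hτ : ∀ ν : MatsubaraIdx M, (ν : ℕ) ≠ 2 * M - 1 → matsubaraInt M (τ ν) = matsubaraInt M ν + 1)
include hσ hτ

omit [NeZero M] in
/-- **Abstract decomposition of the exchange row**: for any `hard soft : FreqMomentum → ℂ` with `hard` vanishing at the two boundary labels and any `F`,
`Σ_p [p.1 ≠ bottom]((soft p)(hard p⁻) + (hard p)(soft p⁻))·F p p⁻ = Σ_pΣ_s (hard p·soft p)·![F p⁺ p, F p p⁻] s + Σ_p hard p·((soft p⁺ − soft p)·F p⁺ p + (soft p⁻ − soft p)·F p p⁻)`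
(`p⁻ = (σ p.1, p.2)`, `p⁺ = (τ p.1, p.2)`): MAIN (same-label line pair) + CORRECTION (shifted soft line minus unshifted). -/
theorem klph_exchange_decomp_abstract [NeZero M] (hard soft : FreqMomentum L M → ℂ) (F : FreqMomentum L M → FreqMomentum L M → ℂ)
    (hbot : ∀ p : FreqMomentum L M, (p.1 : ℕ) = 0 → hard p = 0) (htop : ∀ p : FreqMomentum L M, (p.1 : ℕ) = 2 * M - 1 → hard p = 0) :
    (∑ p : FreqMomentum L M, if (p.1 : ℕ) = 0 then 0 else (soft p * hard (σ p.1, p.2) + hard p * soft (σ p.1, p.2)) * F p (σ p.1, p.2)) =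
      (∑ p : FreqMomentum L M, ∑ s : Fin 2, (hard p * soft p) * (![F (τ p.1, p.2) p, F p (σ p.1, p.2)] : Fin 2 → ℂ) s) +
        ∑ p : FreqMomentum L M, hard p * ((soft (τ p.1, p.2) - soft p) * F (τ p.1, p.2) p + (soft (σ p.1, p.2) - soft p) * F p (σ p.1, p.2)) := by
  -- split the two orderings
  have hsplit : (∑ p : FreqMomentum L M, if (p.1 : ℕ) = 0 then 0 else (soft p * hard (σ p.1, p.2) + hard p * soft (σ p.1, p.2)) * F p (σ p.1, p.2)) =
      (∑ p : FreqMomentum L M, if (p.1 : ℕ) = 0 then 0 else soft p * hard (σ p.1, p.2) * F p (σ p.1, p.2)) +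
        ∑ p : FreqMomentum L M, if (p.1 : ℕ) = 0 then 0 else hard p * soft (σ p.1, p.2) * F p (σ p.1, p.2) := by
    rw [← sum_add_distrib]
    refine sum_congr rfl fun p _ => ?_
    split_ifs <;> ring
  -- reindex the first ordering onto the hard label and drop both indicators
  have hre := klph_sum_shift_reindex (L := L) hσ hτ (fun p q => soft p * hard q * F p q)
  have hA : (∑ p : FreqMomentum L M, if (p.1 : ℕ) = 0 then 0 else soft p * hard (σ p.1, p.2) * F p (σ p.1, p.2)) =
      ∑ q : FreqMomentum L M, hard q * (soft (τ q.1, q.2) * F (τ q.1, q.2) q) := by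
    rw [hre]
    refine sum_congr rfl fun q _ => ?_
    by_cases hq : (q.1 : ℕ) = 2 * M - 1
    · rw [if_pos hq, htop q hq, zero_mul]
    · rw [if_neg hq]; ring
  have hB : (∑ p : FreqMomentum L M, if (p.1 : ℕ) = 0 then 0 else hard p * soft (σ p.1, p.2) * F p (σ p.1, p.2)) =
      ∑ p : FreqMomentum L M, hard p * (soft (σ p.1, p.2) * F p (σ p.1, p.2)) := by
    refine sum_congr rfl fun p _ => ?_
    by_cases hp : (p.1 : ℕ) = 0
    · rw [if_pos hp, hbot p hp, zero_mul]
    · rw [if_neg hp]; ring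
  rw [hsplit, hA, hB, ← sum_add_distrib, ← sum_add_distrib]
  refine sum_congr rfl fun p _ => ?_
  simp only [Fin.sum_univ_two, Matrix.cons_val_zero, Matrix.cons_val_one]
  ring

omit [NeZero M] hσ hτ in
/-- **Abstract bound of the correction**: if `‖hard p‖ ≤ H`, `‖soft p^± − soft p‖ ≤ E` and `‖F p⁺ p‖, ‖F p p⁻‖ ≤ F∞` wherever `hard p ≠ 0`, then
`‖Σ_p hard p·((soft p⁺ − soft p)·F p⁺ p + (soft p⁻ − soft p)·F p p⁻)‖ ≤ #{p : hard p ≠ 0}·(H·(2·E·F∞))`. -/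
theorem klph_exchange_corr_abstract_le [NeZero M] (hard soft : FreqMomentum L M → ℂ) (F : FreqMomentum L M → FreqMomentum L M → ℂ)
    {H E Finf : ℝ} (hH0 : 0 ≤ H) (hE0 : 0 ≤ E)
    (hH : ∀ p, hard p ≠ 0 → ‖hard p‖ ≤ H)
    (hE : ∀ p, hard p ≠ 0 → ‖soft (τ p.1, p.2) - soft p‖ ≤ E ∧ ‖soft (σ p.1, p.2) - soft p‖ ≤ E)
    (hF : ∀ p, hard p ≠ 0 → ‖F (τ p.1, p.2) p‖ ≤ Finf ∧ ‖F p (σ p.1, p.2)‖ ≤ Finf) :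
    ‖∑ p : FreqMomentum L M, hard p * ((soft (τ p.1, p.2) - soft p) * F (τ p.1, p.2) p + (soft (σ p.1, p.2) - soft p) * F p (σ p.1, p.2))‖ ≤
      ((univ.filter fun p : FreqMomentum L M => hard p ≠ 0).card : ℝ) * (H * (2 * E * Finf)) := by
  classical
  have hpt : ∀ p : FreqMomentum L M,
      ‖hard p * ((soft (τ p.1, p.2) - soft p) * F (τ p.1, p.2) p + (soft (σ p.1, p.2) - soft p) * F p (σ p.1, p.2))‖ ≤
        if hard p ≠ 0 then H * (2 * E * Finf) else 0 := by
    intro p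
    by_cases hp : hard p = 0
    · simp [hp]
    · rw [if_pos hp, norm_mul]
      obtain ⟨hE1, hE2⟩ := hE p hp
      obtain ⟨hF1, hF2⟩ := hF p hp
      have h2 : ‖(soft (τ p.1, p.2) - soft p) * F (τ p.1, p.2) p + (soft (σ p.1, p.2) - soft p) * F p (σ p.1, p.2)‖ ≤ 2 * E * Finf := by
        refine (norm_add_le _ _).trans ?_
        rw [norm_mul, norm_mul]
        have := mul_le_mul hE1 hF1 (norm_nonneg _) hE0
        have := mul_le_mul hE2 hF2 (norm_nonneg _) hE0
        linarith
      exact mul_le_mul (hH p hp) h2 (norm_nonneg _) hH0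
  calc ‖∑ p : FreqMomentum L M, hard p * ((soft (τ p.1, p.2) - soft p) * F (τ p.1, p.2) p + (soft (σ p.1, p.2) - soft p) * F p (σ p.1, p.2))‖
      ≤ ∑ p : FreqMomentum L M, ‖hard p * ((soft (τ p.1, p.2) - soft p) * F (τ p.1, p.2) p + (soft (σ p.1, p.2) - soft p) * F p (σ p.1, p.2))‖ := norm_sum_le _ _
    _ ≤ ∑ p : FreqMomentum L M, (if hard p ≠ 0 then H * (2 * E * Finf) else 0) := sum_le_sum fun p _ => hpt p
    _ = ((univ.filter fun p : FreqMomentum L M => hard p ≠ 0).card : ℝ) * (H * (2 * E * Finf)) := by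
        rw [← sum_filter, sum_const, nsmul_eq_mul]

end Decomp

end Summit.HubbardSuperconductivity.HubbardSuperconductivity.Theorems.KLRegimeSplit

end
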